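import Literature.Analysis.FluidPDE.LeiZhang2011EnergyEstimate
import Literature.Analysis.FluidPDE.CylindricalCutoff
import HarnessLib

/-!
# Lei–Ren–Zhang 2019, §2: the energy inequality per period ((2.3)–(2.8))

Analysis/FluidPDE proofs file (theorems only, no definitions, no named facts), on the discharge
path of the named fact `Literature.Analysis.FluidPDE.leiRenZhang2019_liouville_periodic`
(Z. Lei, X. Ren, Q. S. Zhang, *On ancient periodic solutions to axially-symmetric Navier–Stokes
equations*, arXiv:1902.11229 = Math. Ann. 383 (2022), Theorem 1.1). In the proof of the local
maximum estimate (Lemma 2.1, arXiv pp. 5–6) the equation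
`∂ₜΛ − ΔΛ + (2/r)∂ᵣΛ + b·∇Λ = 0` for a `z`-periodic `Λ` (period `Z₀`) vanishing on the axis, with
a `z`-periodic divergence-free drift `b = v_r e_r + v_θ e_θ + v_z e_z`, is tested against
`Λ ψ_R²` with the `z`-independent cut-off `ψ_R = φ(r)η(s)` of (2.2), all integrals being taken over
one period `D_R = {r < R} × [0, Z₀)`:

* (2.3) the energy identity; (2.4) "we use `∇·b = 0` to get
  `−∬ (b·∇)Λ² ψ_R² = ∬ v_r Λ² ∂ᵣψ_R²`" — the `v_z`-part and all boundary terms in `z` vanish by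
  periodicity;
* (2.5)–(2.6) "Let `L_θ` be the angular stream function … `v_r = −∂_z L_θ = ∂_z(L_θ(r,z,t) − L_θ(r,0,t))`
  … `|L_θ(r,z,t) − L_θ(r,0,t)| ≤ sup|v_r| Z₀ ≲ 1`. Hence
  `∬ v_r Λ² ∂ᵣψ_R² = ∬ −(L_θ(r,z,t) − L_θ(r,0,t)) ∂_zΛ² ∂ᵣψ_R² ≤ C∬Λ²(∂ᵣψ_R)² + ⅛∬(∂_zΛ)²ψ_R²`";
* (2.7) the axis term `−∬ (2/r)∂ᵣΛ² ψ_R² = ∬ 2Λ² ∂ᵣψ_R²/r ≤ …` (it has a sign for radially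
  non-increasing `ψ_R`, as in the tree's Lei–Zhang 2011 chain);
* (2.8) the energy inequality
  `sup_t ‖Λφ_R‖²_{L²} + ‖∇(Λψ_R)‖²_{L²L²} ≤ C (σ₁−σ₂)⁻²R⁻² ∬_{P(σ₁R)} Λ²`.

**Tree rendering.** The tree's Lei–Zhang 2011 chain proves the whole-space energy identity for
the time-integrated swirl equation with an arbitrary `C²_c` axisymmetric cut-off
(`LeiZhang2011.energy_identity`, drift with a `BMO` stream function). Here the drift is a `C¹`
divergence-free periodic field and the cut-off is `φ̃(x) = ψ(x) ω(x₂)` with `ψ` a `z`-independent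
radial cut-off (`CylindricalCutoff`) and `ω = periodicWindow P` the periodic window of
`PeriodicWindowIntegral` (`Σ_k ω(z + kP)² = 1`): whole-space integrals against `ω(x₂)²` of
periodic quantities ARE integrals over one period (`integral_mul_periodicWindow_sq`), and every
term containing `(ω²)′` integrates to zero (`integral_mul_deriv_periodicWindow_sq_eq_zero`) — this
is the tree form of "the boundary terms in `z` vanish by periodicity". The angular stream function
enters through a potential `Φ(s,·) ∈ C¹`, periodic, with `∂_zΦ = ⟪b, x_h⟫ = r v_r` and
`|Φ| ≤ C_Φ r` (for the swirl setting: `Φ(x) = ∫₀^{x₂} r v_r`, `C_Φ = Z₀ sup|v_r|`), so that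
`⟪b, ∇ψ²⟫ = 2ψ a ∂_zΦ` for `∇ψ = a x_h` and the `z`-integration by parts of (2.6) is the
whole-space identity `∫ ∂_z(ΦΘ) = 0`.

Contents: the transport slice identity for divergence-free `C¹` drifts
(`integral_inner_gradient_mul_deriv_comp_mul_sq_divFree`, replacing the stream-function version
of `LeiZhang2011Proofs`); the slice form of the tested equation
(`integral_deriv_comp_mul_rhs_mul_sq_eq`, (2.3) for a general convex `H`, as in the tree's
Lei–Zhang chain: `H(Λ) = Λ^{2q}` in print); the per-period estimates of the cut-off terms
((2.4)–(2.7): `abs_viscousCutoff_window_le`, `drift_window_le`); and the **energy inequality per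
period in time-integrated form** (`energy_inequality_periodic`, (2.8) before Sobolev):
`η(t₂)M(t₂) + (1−2ε)∫η G ≤ ∫ (η (κ/ε)(1 + C_Φ²) P_ψ + |η′| M)` with the slab functionals
`M = ∫_{slab} H(Λ)ψ²`, `G = ∫_{slab} H″(Λ)‖∇Λ‖²ψ²`, `P_ψ = ∫_{slab} H(Λ)‖∇ψ‖²`.

## References

* Z. Lei, X. Ren, Q. S. Zhang, arXiv:1902.11229, §2, proof of Lemma 2.1, (2.3)–(2.8)
  (arXiv pp. 5–6). [LeiRenZhang2019]
* Z. Lei, Q. S. Zhang, J. Funct. Anal. 261 (2011) = arXiv:1011.5066, §2 (2.2)–(2.4) (the scheme;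
  tree `LeiZhang2011Energy`, `LeiZhang2011EnergyEstimate`). [LeiZhang2011]
-/

noncomputable section

open MeasureTheory Set Function Filter Metric intervalIntegral
open _root_.Topology
open scoped InnerProductSpace RealInnerProductSpace NNReal ENNReal Laplacian

namespace Literature.Analysis.FluidPDE

namespace LeiRenZhang2019

open LeiZhang2011

/-! ### Plumbing: periodicity, axial derivatives -/

/-- `‖e_z‖ = 1`. [folklore] -/
private theorem norm_eZ_pse : ‖(eZ : EuclideanSpace ℝ (Fin 3))‖ = 1 := by
  have h : (eZ : EuclideanSpace ℝ (Fin 3)) = PiLp.single 2 (2 : Fin 3) (1 : ℝ) := rfl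
  rw [h, PiLp.norm_single, norm_one]

/-- Unfolding of axial periodicity with `eZ`. [folklore] -/
private theorem periodic_apply_pse {α : Sort*} {P : ℝ} {Q : EuclideanSpace ℝ (Fin 3) → α}
    (hQ : IsAxiallyPeriodic P Q) (x : EuclideanSpace ℝ (Fin 3)) : Q (x + P • eZ) = Q x :=
  hQ x

/-- Axial periodicity from its `eZ` form. [folklore] -/
private theorem periodic_of_eZ_pse {α : Sort*} {P : ℝ} {Q : EuclideanSpace ℝ (Fin 3) → α}
    (hQ : ∀ x : EuclideanSpace ℝ (Fin 3), Q (x + P • eZ) = Q x) : IsAxiallyPeriodic P Q :=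
  hQ

/-- A function invariant under all axial translations is axially periodic. [folklore] -/
private theorem periodic_of_forall_add_smul_pse {α : Sort*} {P : ℝ} {c : EuclideanSpace ℝ (Fin 3) → α}
    (hc : ∀ (x : EuclideanSpace ℝ (Fin 3)) (t : ℝ), c (x + t • eZ) = c x) : IsAxiallyPeriodic P c :=
  fun x => hc x P

/-- The derivative of a periodic function is periodic. [folklore] -/
private theorem periodic_fderiv_pse {P : ℝ} {f : EuclideanSpace ℝ (Fin 3) → ℝ}
    (hf : IsAxiallyPeriodic P f) : IsAxiallyPeriodic P (fderiv ℝ f) := by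
  intro x
  have hfun : (fun y => f (y + P • EuclideanSpace.single (2 : Fin 3) (1 : ℝ))) = f := funext hf
  have h := fderiv_comp_add_right (𝕜 := ℝ) (f := f) (x := x)
    (P • EuclideanSpace.single (2 : Fin 3) (1 : ℝ))
  rw [hfun] at h
  exact h.symm

/-- **The axial derivative of a `z`-invariant function vanishes.** [folklore] -/
private theorem fderiv_eZ_eq_zero_of_forall_add_smul_pse {c : EuclideanSpace ℝ (Fin 3) → ℝ}
    {x : EuclideanSpace ℝ (Fin 3)} (hcd : DifferentiableAt ℝ c x)
    (hc : ∀ t : ℝ, c (x + t • eZ) = c x) : fderiv ℝ c x eZ = 0 := by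
  have hline : HasDerivAt (fun t : ℝ => x + t • (eZ : EuclideanSpace ℝ (Fin 3))) eZ 0 := by
    have h := ((hasDerivAt_id (0 : ℝ)).smul_const (eZ : EuclideanSpace ℝ (Fin 3))).const_add x
    simpa using h
  have hx0 : x + (0 : ℝ) • (eZ : EuclideanSpace ℝ (Fin 3)) = x := by simp
  have hcd' : DifferentiableAt ℝ c (x + (0 : ℝ) • (eZ : EuclideanSpace ℝ (Fin 3))) := by rwa [hx0]
  have hcomp := hcd'.hasFDerivAt.comp_hasDerivAt (0 : ℝ) hline
  rw [hx0] at hcomp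
  have hconst : HasDerivAt (fun t : ℝ => c (x + t • (eZ : EuclideanSpace ℝ (Fin 3)))) 0 0 := by
    have : (fun t : ℝ => c (x + t • (eZ : EuclideanSpace ℝ (Fin 3)))) = fun _ => c x := funext hc
    rw [this]
    exact hasDerivAt_const _ _
  exact hcomp.unique hconst

/-- `|∂_z F| ≤ ‖∇F‖`. [folklore] -/
private theorem abs_fderiv_eZ_le_norm_gradient_pse (F : EuclideanSpace ℝ (Fin 3) → ℝ)
    (x : EuclideanSpace ℝ (Fin 3)) : |fderiv ℝ F x eZ| ≤ ‖gradient F x‖ := by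
  rw [← inner_gradient_left, ← Real.norm_eq_abs]
  calc ‖⟪gradient F x, eZ⟫‖ ≤ ‖gradient F x‖ * ‖(eZ : EuclideanSpace ℝ (Fin 3))‖ := norm_inner_le_norm _ _
    _ = ‖gradient F x‖ := by rw [norm_eZ_pse, mul_one]

/-- `∇(φ²) = 2φ ∇φ`. [folklore] -/
private theorem gradient_sq_pse {φ : EuclideanSpace ℝ (Fin 3) → ℝ} {x : EuclideanSpace ℝ (Fin 3)}
    (hd : DifferentiableAt ℝ φ x) : gradient (fun y => φ y ^ 2) x = (2 * φ x) • gradient φ x := by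
  have h := gradient_comp_apply (H := fun t : ℝ => t ^ 2) (F := φ) ((differentiable_pow 2) (φ x)) hd
  simp only [deriv_pow_field, Nat.cast_ofNat, Nat.add_one_sub_one, pow_one] at h
  exact h

/-- The periodic window is supported in `|z| ≤ 2P`. [folklore] -/
private theorem abs_le_of_periodicWindow_ne_zero_pse {P : ℝ} (hP : 0 < P) (z : ℝ)
    (hz : periodicWindow P z ≠ 0) : |z| ≤ 2 * P := by
  have h := mem_Ioo_of_periodicWindow_ne_zero hP hz
  rw [abs_le]
  exact ⟨by linarith [h.1], h.2.le⟩

/-- The squared window is supported in `|z| ≤ 2P`. [folklore] -/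
private theorem abs_le_of_periodicWindow_sq_ne_zero_pse {P : ℝ} (hP : 0 < P) (z : ℝ)
    (hz : periodicWindow P z ^ 2 ≠ 0) : |z| ≤ 2 * P :=
  abs_le_of_periodicWindow_ne_zero_pse hP z fun h => hz (by rw [h]; ring)

/-- A function vanishing for `r ≥ ρ` has zero derivative for `r > ρ`. [folklore] -/
private theorem fderiv_eq_zero_of_lt_cylRadius_pse {ψ : EuclideanSpace ℝ (Fin 3) → ℝ} {ρ : ℝ}
    (hψ0 : ∀ x, ρ ≤ cylRadius x → ψ x = 0) {x : EuclideanSpace ℝ (Fin 3)} (hx : ρ < cylRadius x) :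
    fderiv ℝ ψ x = 0 := by
  have hopen : IsOpen {y : EuclideanSpace ℝ (Fin 3) | ρ < cylRadius y} :=
    isOpen_lt continuous_const continuous_cylRadius
  have hev : ψ =ᶠ[𝓝 x] fun _ => 0 := by
    filter_upwards [hopen.mem_nhds hx] with y hy
    exact hψ0 y (le_of_lt hy)
  rw [hev.fderiv_eq, fderiv_const_apply]

/-- Hence `‖∇ψ‖` vanishes for `r ≥ ρ + 1`. [folklore] -/
private theorem gradient_eq_zero_of_le_cylRadius_pse {ψ : EuclideanSpace ℝ (Fin 3) → ℝ} {ρ : ℝ}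
    (hψ0 : ∀ x, ρ ≤ cylRadius x → ψ x = 0) {x : EuclideanSpace ℝ (Fin 3)} (hx : ρ + 1 ≤ cylRadius x) :
    gradient ψ x = 0 := by
  rw [gradient, fderiv_eq_zero_of_lt_cylRadius_pse hψ0 (by linarith), map_zero]

/-! ### The transport term for a divergence-free `C¹` drift -/

/-- **The drift term for a divergence-free drift** ("we use `∇·b = 0`", (2.4)):
`∫ ⟪b, ∇F⟫ H'(F) φ² = −∫ H(F) ⟪b, ∇(φ²)⟫` for `b ∈ C¹` with `div b = 0`, `F, H ∈ C²`,
`φ ∈ C²_c` (`θ = H(F)φ² ∈ C¹_c`, `∫ θ div b + ∫ ⟪b, ∇θ⟫ = 0`, `∇θ = φ²H'(F)∇F + H(F)∇φ²`). [cite: LeiRenZhang2019, §2 (2.4) (the transport term, using ∇·b = 0), arXiv p. 5] -/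
theorem integral_inner_gradient_mul_deriv_comp_mul_sq_divFree
    {b : EuclideanSpace ℝ (Fin 3) → EuclideanSpace ℝ (Fin 3)} (hb : ContDiff ℝ 1 b)
    (hbdiv : ∀ x, VectorCalculus.divergence b x = 0)
    {F : EuclideanSpace ℝ (Fin 3) → ℝ} (hF : ContDiff ℝ 2 F) {H : ℝ → ℝ} (hH : ContDiff ℝ 2 H)
    {φ : EuclideanSpace ℝ (Fin 3) → ℝ} (hφ : ContDiff ℝ 2 φ) (hφc : HasCompactSupport φ) :
    ∫ x, ⟪b x, gradient F x⟫ * (deriv H (F x) * φ x ^ 2) =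
      -∫ x, H (F x) * ⟪b x, gradient (fun y => φ y ^ 2) x⟫ := by
  -- the test function `θ = H(F) φ²`
  set θ : EuclideanSpace ℝ (Fin 3) → ℝ := fun y => H (F y) * φ y ^ 2 with hθ
  have hHF1 : ContDiff ℝ 1 fun y => H (F y) := (hH.of_le one_le_two).comp (hF.of_le one_le_two)
  have hφ2 : ContDiff ℝ 1 fun y => φ y ^ 2 := (hφ.of_le one_le_two).pow 2
  have hθ1 : ContDiff ℝ 1 θ := hHF1.mul hφ2
  have hφ2c : HasCompactSupport fun y => φ y ^ 2 :=
    hφc.comp_left (g := fun t : ℝ => t ^ 2) (by simp)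
  have hθc : HasCompactSupport θ := hφ2c.mul_left
  -- `∫ θ div b + ∫ ⟪b, ∇θ⟫ = 0` and `div b = 0`
  have h0 := integral_mul_divergence_add_eq_zero_left hθ1 hb hθc
  have hdiv0 : ∫ x, θ x * VectorCalculus.divergence b x = 0 := by
    simp only [hbdiv, mul_zero, integral_zero]
  rw [hdiv0, zero_add] at h0
  -- `⟪b, ∇θ⟫ = φ² H'(F) ⟪b, ∇F⟫ + H(F) ⟪b, ∇φ²⟫`
  have hgradθ : ∀ x, ⟪b x, gradient θ x⟫ =
      ⟪b x, gradient F x⟫ * (deriv H (F x) * φ x ^ 2) + H (F x) * ⟪b x, gradient (fun y => φ y ^ 2) x⟫ := by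
    intro x
    have hdHF : DifferentiableAt ℝ (fun y => H (F y)) x := (hHF1.differentiable one_ne_zero) x
    have hdφ2 : DifferentiableAt ℝ (fun y => φ y ^ 2) x := (hφ2.differentiable one_ne_zero) x
    have hg : gradient θ x = H (F x) • gradient (fun y => φ y ^ 2) x +
        (φ x ^ 2) • gradient (fun y => H (F y)) x := by
      simp only [hθ, gradient, fderiv_fun_mul hdHF hdφ2, map_add, map_smul]
    rw [hg, gradient_comp_apply ((hH.differentiable two_ne_zero) (F x))
      ((hF.differentiable two_ne_zero) x), inner_add_right, real_inner_smul_right,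
      real_inner_smul_right, real_inner_smul_right]
    ring
  -- integrability of the two pieces
  have hgradF : Continuous (gradient F) := continuous_gradient_of_contDiff (hF.of_le one_le_two)
  have hgradφ2 : Continuous (gradient fun y => φ y ^ 2) := continuous_gradient_of_contDiff hφ2
  have hgradφ2c : HasCompactSupport (gradient fun y => φ y ^ 2) :=
    HasCompactSupport.intro hφ2c fun x hx => gradient_eq_zero_of_notMem_tsupport hx
  have hσc : Continuous fun x => deriv H (F x) * φ x ^ 2 :=
    ((hH.continuous_deriv (by norm_num)).comp hF.continuous).mul (hφ.continuous.pow 2)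
  have hi1 : Integrable (fun x => ⟪b x, gradient F x⟫ * (deriv H (F x) * φ x ^ 2))
      (volume : Measure (EuclideanSpace ℝ (Fin 3))) :=
    ((hb.continuous.inner hgradF).mul hσc).integrable_of_hasCompactSupport (hφ2c.mul_left.mul_left)
  have hi2 : Integrable (fun x => H (F x) * ⟪b x, gradient (fun y => φ y ^ 2) x⟫)
      (volume : Measure (EuclideanSpace ℝ (Fin 3))) := by
    refine ((hH.continuous.comp hF.continuous).mul (hb.continuous.inner hgradφ2)).integrable_of_hasCompactSupport ?_
    refine hgradφ2c.mono fun x hx => ?_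
    contrapose! hx
    simp only [mem_support, not_not] at hx ⊢
    simp only [Pi.mul_apply, Function.comp_apply, hx, inner_zero_right, mul_zero]
  simp_rw [hgradθ] at h0
  rw [integral_add hi1 hi2] at h0
  linarith

/-! ### The tested equation on a slice ((2.3) for a general `H`) -/

/-- **The tested equation on a slice** (the identity behind (2.3), general convex `H` and an
arbitrary axisymmetric `C²_c` cut-off `φ`, drift `b ∈ C¹` divergence free): for axisymmetric
`F ∈ C²` vanishing on the axis and `H ∈ C²` with `H(0) = 0`,
`∫ H'(F)(ΔF − DF[b] − (2/r)∂ᵣF) φ² = −(∫ H″(F)‖∇F‖²φ² + H'(F)⟪∇F,∇φ²⟫) + ∫ H(F)⟪b,∇φ²⟫ + ∫ (2/r)H(F)∂ᵣφ²`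
(viscous term by Green's identity, transport term by `∇·b = 0`, axis term by parts in `r`
using `F = 0` on the axis); every integrand on the right, and the one on the left, is integrable. [cite: LeiRenZhang2019, §2 (2.3)–(2.4) and (2.7) (testing the equation by Λψ_R²), arXiv pp. 5–6] -/
theorem integral_deriv_comp_mul_rhs_mul_sq_eq {F : EuclideanSpace ℝ (Fin 3) → ℝ}
    {b : EuclideanSpace ℝ (Fin 3) → EuclideanSpace ℝ (Fin 3)}
    (hF2 : ContDiff ℝ 2 F) (hFa : IsAxisymmetricScalar F) (hF0 : ∀ x, cylRadius x = 0 → F x = 0)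
    (hb1 : ContDiff ℝ 1 b) (hbdiv : ∀ x, VectorCalculus.divergence b x = 0)
    {H : ℝ → ℝ} (hH : ContDiff ℝ 2 H) (hH0 : H 0 = 0)
    {φ : EuclideanSpace ℝ (Fin 3) → ℝ} (hφ : ContDiff ℝ 2 φ) (hφc : HasCompactSupport φ)
    (hφa : IsAxisymmetricScalar φ) :
    Integrable (fun x => deriv H (F x) *
        ((Δ F) x - fderiv ℝ F x (b x) - 2 / cylRadius x * fderiv ℝ F x (eR x)) * φ x ^ 2)
      (volume : Measure (EuclideanSpace ℝ (Fin 3))) ∧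
    ∫ x, deriv H (F x) * ((Δ F) x - fderiv ℝ F x (b x) - 2 / cylRadius x * fderiv ℝ F x (eR x)) *
        φ x ^ 2 =
      -(∫ x, (deriv (deriv H) (F x) * ‖gradient F x‖ ^ 2 * φ x ^ 2 +
          deriv H (F x) * ⟪gradient F x, gradient (fun y => φ y ^ 2) x⟫)) +
        (∫ x, H (F x) * ⟪b x, gradient (fun y => φ y ^ 2) x⟫) +
        ∫ x, 2 / cylRadius x * (H (F x) * fderiv ℝ (fun y => φ y ^ 2) x (eR x)) := by
  have hH1 : ContDiff ℝ 1 H := hH.of_le one_le_two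
  have hφ1 : ContDiff ℝ 1 φ := hφ.of_le one_le_two
  have hφ2c : HasCompactSupport fun y => φ y ^ 2 :=
    hφc.comp_left (g := fun t : ℝ => t ^ 2) (by simp)
  -- the three pieces and their integrability
  set P₁ : EuclideanSpace ℝ (Fin 3) → ℝ := fun x => deriv H (F x) * φ x ^ 2 * (Δ F) x with hP₁
  set P₂ : EuclideanSpace ℝ (Fin 3) → ℝ := fun x =>
    ⟪b x, gradient F x⟫ * (deriv H (F x) * φ x ^ 2) with hP₂
  set P₃ : EuclideanSpace ℝ (Fin 3) → ℝ := fun x =>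
    2 / cylRadius x * (fderiv ℝ F x (eR x) * (deriv H (F x) * φ x ^ 2)) with hP₃
  have hHF : Continuous fun x => deriv H (F x) :=
    (hH.continuous_deriv (by norm_num)).comp hF2.continuous
  have hσc : Continuous fun x => deriv H (F x) * φ x ^ 2 := hHF.mul (hφ.continuous.pow 2)
  have hσcs : HasCompactSupport fun x => deriv H (F x) * φ x ^ 2 := hφ2c.mul_left
  have hΔc : Continuous (Δ F) := by
    have h2 : ContDiff ℝ ((0 : ℕ∞) + 2 : ℕ∞) F := by simpa using hF2
    exact (contDiff_laplacian (n := 0) h2).continuous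
  have hiP₁ : Integrable P₁ (volume : Measure (EuclideanSpace ℝ (Fin 3))) :=
    (hσc.mul hΔc).integrable_of_hasCompactSupport hσcs.mul_right
  have hgradF : Continuous (gradient F) := continuous_gradient_of_contDiff (hF2.of_le one_le_two)
  have hiP₂ : Integrable P₂ (volume : Measure (EuclideanSpace ℝ (Fin 3))) :=
    ((hb1.continuous.inner hgradF).mul hσc).integrable_of_hasCompactSupport hσcs.mul_left
  have hHFs1 : ContDiff ℝ 1 fun x => H (F x) := hH1.comp (hF2.of_le one_le_two)
  have hHFa : IsAxisymmetricScalar fun x => H (F x) := fun θ x => by simp only [hFa θ x]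
  have hHF0 : ∀ x, cylRadius x = 0 → H (F x) = 0 := fun x hx => by rw [hF0 x hx, hH0]
  have hφ2C : ContDiff ℝ 1 fun y => φ y ^ 2 := hφ1.pow 2
  have hφ2a : IsAxisymmetricScalar fun y => φ y ^ 2 := fun θ x => by simp only [hφa θ x]
  have hiP₃ : Integrable P₃ (volume : Measure (EuclideanSpace ℝ (Fin 3))) := by
    have h := integrable_two_div_cylRadius_mul_fderiv_eR_mul hHFs1 hφ2C hφ2c hHFa hφ2a hHF0
    refine h.congr (Eventually.of_forall fun x => ?_)
    have hd : fderiv ℝ (fun y => H (F y)) x = deriv H (F x) • fderiv ℝ F x :=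
      ((((hH.differentiable two_ne_zero) (F x)).hasDerivAt).comp_hasFDerivAt x
        ((hF2.differentiable two_ne_zero) x).hasFDerivAt).fderiv
    simp only [hP₃, hd, FunLike.coe_smul, Pi.smul_apply, smul_eq_mul]
    ring
  -- pointwise: the integrand is `P₁ − P₂ − P₃`
  have hpt : ∀ x, deriv H (F x) *
      ((Δ F) x - fderiv ℝ F x (b x) - 2 / cylRadius x * fderiv ℝ F x (eR x)) * φ x ^ 2 =
        P₁ x - P₂ x - P₃ x := by
    intro x
    simp only [hP₁, hP₂, hP₃, ← inner_gradient_left F x (b x), real_inner_comm (b x)]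
    ring
  have hint : Integrable (fun x => deriv H (F x) *
      ((Δ F) x - fderiv ℝ F x (b x) - 2 / cylRadius x * fderiv ℝ F x (eR x)) * φ x ^ 2)
      (volume : Measure (EuclideanSpace ℝ (Fin 3))) := by
    have h := (hiP₁.sub' hiP₂).sub' hiP₃
    exact h.congr (Eventually.of_forall fun x => by simp only [hpt x])
  refine ⟨hint, ?_⟩
  simp_rw [hpt]
  rw [integral_sub (hiP₁.sub' hiP₂) hiP₃, integral_sub hiP₁ hiP₂]
  -- the slice identities
  have e₁ : ∫ x, P₁ x = -∫ x, (deriv (deriv H) (F x) * ‖gradient F x‖ ^ 2 * φ x ^ 2 +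
      deriv H (F x) * ⟪gradient F x, gradient (fun y => φ y ^ 2) x⟫) :=
    integral_laplacian_mul_deriv_comp_mul_sq hF2 hH hφ1 hφc
  have e₂ : ∫ x, P₂ x = -∫ x, H (F x) * ⟪b x, gradient (fun y => φ y ^ 2) x⟫ :=
    integral_inner_gradient_mul_deriv_comp_mul_sq_divFree hb1 hbdiv hF2 hH hφ hφc
  have e₃ : ∫ x, P₃ x = -∫ x, 2 / cylRadius x * (H (F x) * fderiv ℝ (fun y => φ y ^ 2) x (eR x)) :=
    integral_two_div_cylRadius_mul_fderiv_eR_mul_deriv_comp_mul_sq (hF2.of_le one_le_two)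
      hFa hF0 hH1 hH0 hφ1 hφc hφa
  rw [e₁, e₂, e₃]
  ring

/-! ### The cut-off `φ̃ = ψ(x) ω(x₂)` and the per-period form of the slice functionals -/

section Window

variable {P : ℝ} {ψ : EuclideanSpace ℝ (Fin 3) → ℝ} {ρ : ℝ}

/-- **Per-period integrals as window integrals**: for a continuous, axially `P`-periodic `Q`
vanishing off the cylinder `{r < ρ}`, `∫ Q(x) ω(x₂)² dx = ∫_{slab} Q` and
`∫ Q(x) (ω²)′(x₂) dx = 0`, `ω = periodicWindow P`. [cite: LeiRenZhang2019, §2 (2.3)–(2.6) (integration over one period D_R; z-boundary terms vanish by periodicity), arXiv pp. 5–6] -/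
theorem integral_mul_window_sq_eq_and_deriv_eq_zero (hP : 0 < P)
    {Q : EuclideanSpace ℝ (Fin 3) → ℝ} (hQc : Continuous Q) (hQp : IsAxiallyPeriodic P Q)
    (hQ0 : ∀ x, ρ ≤ cylRadius x → Q x = 0) :
    (∫ x, Q x * periodicWindow P (x 2) ^ 2 = ∫ x in zSlab P 0, Q x) ∧
      ∫ x, Q x * deriv (fun z => periodicWindow P z ^ 2) (x 2) = 0 := by
  have hQi : IntegrableOn Q (zSlab P 0) volume :=
    integrableOn_zSlab_of_eq_zero_of_le_cylRadius hQc hQ0 P 0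
  exact ⟨integral_mul_periodicWindow_sq hP hQp hQc.aestronglyMeasurable hQi,
    integral_mul_deriv_periodicWindow_sq_eq_zero hP hQp hQc.aestronglyMeasurable hQi⟩

/-- The gradient of `φ̃² = ψ² ω(x₂)²`:
`∇(φ̃²)(x) = ω(x₂)² ∇(ψ²)(x) + ψ(x)² (ω²)′(x₂) e_z`. [cite: LeiRenZhang2019, §2 (2.3) (∇ψ_R² for ψ_R = φ(r)η), arXiv p. 5] -/
theorem gradient_windowCutoff_sq (P : ℝ) (hψ : ContDiff ℝ 1 ψ) (x : EuclideanSpace ℝ (Fin 3)) :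
    gradient (fun y => (ψ y * periodicWindow P (y 2)) ^ 2) x =
      (periodicWindow P (x 2) ^ 2) • gradient (fun y => ψ y ^ 2) x +
        (ψ x ^ 2 * deriv (fun z => periodicWindow P z ^ 2) (x 2)) • eZ := by
  have hfun : (fun y : EuclideanSpace ℝ (Fin 3) => (ψ y * periodicWindow P (y 2)) ^ 2) =
      fun y => (fun y => ψ y ^ 2) y * (fun z => periodicWindow P z ^ 2) (y 2) := by
    funext y; ring
  rw [hfun]
  exact gradient_mul_comp_apply_two (((hψ.pow 2).differentiable one_ne_zero) x)
    (((contDiff_periodicWindow_sq P (n := 1)).differentiable one_ne_zero) _)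

end Window

/-! ### The cut-off terms per period ((2.4)–(2.7)) -/

section CutoffTerms

variable {P : ℝ} {F ψ a : EuclideanSpace ℝ (Fin 3) → ℝ} {ρ : ℝ} {H : ℝ → ℝ} {κ ε : ℝ}

/-- **The viscous cut-off term per period** ((2.7) last display: "`−2∬Λ∇Λ·∇ψ_R² ≤ C∬Λ²|∇ψ_R|² + ⅛∬|∇(Λψ_R)|²`",
here for a general convex `H` with `H'² ≤ κ H H″` as in the tree's Lei–Zhang chain): with
`φ̃ = ψ ω(x₂)`, `ψ` a `z`-independent cut-off vanishing off `{r < ρ}` and `F` axially periodic,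
`|∫ H'(F)⟪∇F, ∇φ̃²⟫| ≤ ε ∫_{slab} H″(F)‖∇F‖²ψ² + (κ/ε) ∫_{slab} H(F)‖∇ψ‖²`
(the `(ω²)′`-term `∫ H'(F)∂_zF ψ² (ω²)′` vanishes by periodicity). [cite: LeiRenZhang2019, §2 (2.7) (the terms 2Λ²|∇ψ_R|² − 2Λ∇Λ·∇ψ_R²), arXiv p. 6] -/
theorem abs_viscousCutoff_window_le (hP : 0 < P) (hF : ContDiff ℝ 2 F) (hFp : IsAxiallyPeriodic P F)
    (hH : ContDiff ℝ 2 H) (hH0 : ∀ v, 0 ≤ H v) (hH2 : ∀ v, 0 ≤ deriv (deriv H) v) (hκ0 : 0 ≤ κ)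
    (hκ : ∀ v, deriv H v ^ 2 ≤ κ * H v * deriv (deriv H) v)
    (hψ : ContDiff ℝ 1 ψ) (hψz : ∀ (x : EuclideanSpace ℝ (Fin 3)) (t : ℝ), ψ (x + t • eZ) = ψ x)
    (hψ0 : ∀ x, ρ ≤ cylRadius x → ψ x = 0) (hε : 0 < ε) :
    |∫ x, deriv H (F x) * ⟪gradient F x, gradient (fun y => (ψ y * periodicWindow P (y 2)) ^ 2) x⟫| ≤
      ε * (∫ x in zSlab P 0, deriv (deriv H) (F x) * ‖gradient F x‖ ^ 2 * ψ x ^ 2) +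
        κ / ε * ∫ x in zSlab P 0, H (F x) * ‖gradient ψ x‖ ^ 2 := by
  have hF1 : ContDiff ℝ 1 F := hF.of_le one_le_two
  have hH' : ContDiff ℝ 1 (deriv H) := by
    have h2 : ContDiff ℝ (1 + 1) H := by rw [one_add_one_eq_two]; exact hH
    exact h2.deriv'
  have hψp : IsAxiallyPeriodic P ψ := periodic_of_forall_add_smul_pse hψz
  -- split `⟪∇F, ∇φ̃²⟫ = ω² ⟪∇F, ∇ψ²⟫ + ψ² (ω²)' ∂_zF`
  set ω2 : ℝ → ℝ := fun z => periodicWindow P z ^ 2 with hω2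
  have hsplit : ∀ x, deriv H (F x) * ⟪gradient F x, gradient (fun y => (ψ y * periodicWindow P (y 2)) ^ 2) x⟫ =
      deriv H (F x) * ⟪gradient F x, gradient (fun y => ψ y ^ 2) x⟫ * periodicWindow P (x 2) ^ 2 +
        (deriv H (F x) * fderiv ℝ F x eZ * ψ x ^ 2) * deriv ω2 (x 2) := by
    intro x
    rw [gradient_windowCutoff_sq P hψ x, inner_add_right, real_inner_smul_right, real_inner_smul_right,
      inner_gradient_left F x eZ]
    ring
  -- the two pieces are integrable; the second integrates to zero
  set Q₁ : EuclideanSpace ℝ (Fin 3) → ℝ := fun x =>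
    deriv H (F x) * ⟪gradient F x, gradient (fun y => ψ y ^ 2) x⟫ with hQ₁
  set Q₂ : EuclideanSpace ℝ (Fin 3) → ℝ := fun x => deriv H (F x) * fderiv ℝ F x eZ * ψ x ^ 2 with hQ₂
  have hHFc : Continuous fun x => deriv H (F x) := (hH.continuous_deriv (by norm_num)).comp hF.continuous
  have hgradF : Continuous (gradient F) := continuous_gradient_of_contDiff hF1
  have hgradψ2 : Continuous (gradient fun y => ψ y ^ 2) := continuous_gradient_of_contDiff (hψ.pow 2)
  have hQ₁c : Continuous Q₁ := hHFc.mul (hgradF.inner hgradψ2)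
  have hFz : Continuous fun x => fderiv ℝ F x eZ := (hF.continuous_fderiv (by norm_num)).clm_apply continuous_const
  have hQ₂c : Continuous Q₂ := (hHFc.mul hFz).mul (hψ.continuous.pow 2)
  -- support: both vanish for `r ≥ ρ + 1`
  have hψ20 : ∀ x, ρ + 1 ≤ cylRadius x → gradient (fun y => ψ y ^ 2) x = 0 := by
    intro x hx
    have h0 : ∀ y, ρ ≤ cylRadius y → ψ y ^ 2 = 0 := fun y hy => by rw [hψ0 y hy]; ring
    exact gradient_eq_zero_of_le_cylRadius_pse h0 hx
  have hQ₁0 : ∀ x, ρ + 1 ≤ cylRadius x → Q₁ x = 0 := fun x hx => by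
    simp only [hQ₁, hψ20 x hx, inner_zero_right, mul_zero]
  have hQ₂0 : ∀ x, ρ ≤ cylRadius x → Q₂ x = 0 := fun x hx => by
    simp only [hQ₂, hψ0 x hx]; ring
  -- periodicity
  have hQ₂p : IsAxiallyPeriodic P Q₂ := periodic_of_eZ_pse fun x => by
    simp only [hQ₂, periodic_apply_pse hFp, periodic_apply_pse hψp, periodic_apply_pse (periodic_fderiv_pse hFp)]
  have hQ₁p : IsAxiallyPeriodic P Q₁ := by
    have hψ2p : IsAxiallyPeriodic P fun y => ψ y ^ 2 := periodic_of_eZ_pse fun x => by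
      simp only [periodic_apply_pse hψp]
    have hg1 : IsAxiallyPeriodic P (gradient F) := periodic_of_eZ_pse fun x => by
      simp only [gradient, periodic_apply_pse (periodic_fderiv_pse hFp)]
    have hg2 : IsAxiallyPeriodic P (gradient fun y => ψ y ^ 2) := periodic_of_eZ_pse fun x => by
      simp only [gradient, periodic_apply_pse (periodic_fderiv_pse hψ2p)]
    refine periodic_of_eZ_pse fun x => ?_
    simp only [hQ₁, periodic_apply_pse hFp, periodic_apply_pse hg1, periodic_apply_pse hg2]
  obtain ⟨-, hQ₂zero⟩ := integral_mul_window_sq_eq_and_deriv_eq_zero hP hQ₂c hQ₂p hQ₂0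
  -- integrability of the pieces of the window integral
  have hW2 : ∀ z, ω2 z ≠ 0 → |z| ≤ 2 * P := fun z hz => abs_le_of_periodicWindow_sq_ne_zero_pse hP z hz
  have hW2c : Continuous ω2 := (contDiff_periodicWindow_sq P (n := 1)).continuous
  have hW2' : Continuous (deriv ω2) := (contDiff_periodicWindow_sq P (n := 1)).continuous_deriv le_rfl
  have hW2'cs : HasCompactSupport (deriv ω2) := (hasCompactSupport_periodicWindow_sq hP).deriv
  obtain ⟨A, hA⟩ : ∃ A : ℝ, ∀ z, deriv ω2 z ≠ 0 → |z| ≤ A := by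
    obtain ⟨A, hA⟩ := (hW2'cs.isCompact.isBounded).subset_closedBall 0
    exact ⟨A, fun z hz => by
      have := hA (subset_tsupport _ (mem_support.2 hz))
      rwa [mem_closedBall_zero_iff, Real.norm_eq_abs] at this⟩
  have hx2c : Continuous fun x : EuclideanSpace ℝ (Fin 3) => x 2 :=
    (EuclideanSpace.proj (𝕜 := ℝ) (2 : Fin 3)).continuous
  have hi1 : Integrable (fun x => Q₁ x * periodicWindow P (x 2) ^ 2)
      (volume : Measure (EuclideanSpace ℝ (Fin 3))) :=
    (hQ₁c.mul (hW2c.comp hx2c)).integrable_of_hasCompactSupport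
      (hasCompactSupport_mul_comp_apply_two (W := ω2) hQ₁0 hW2)
  have hi2 : Integrable (fun x => Q₂ x * deriv ω2 (x 2))
      (volume : Measure (EuclideanSpace ℝ (Fin 3))) :=
    (hQ₂c.mul (hW2'.comp hx2c)).integrable_of_hasCompactSupport
      (hasCompactSupport_mul_comp_apply_two (W := deriv ω2) hQ₂0 hA)
  have hsum : ∫ x, deriv H (F x) * ⟪gradient F x, gradient (fun y => (ψ y * periodicWindow P (y 2)) ^ 2) x⟫ =
      ∫ x, Q₁ x * periodicWindow P (x 2) ^ 2 := by
    simp_rw [hsplit]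
    rw [integral_add hi1 hi2, hQ₂zero, add_zero]
  rw [hsum]
  -- pointwise Young on the first piece
  have hgrad2 : ∀ x, gradient (fun y => ψ y ^ 2) x = (2 * ψ x) • gradient ψ x := fun x =>
    gradient_sq_pse ((hψ.differentiable one_ne_zero) x)
  have hpt : ∀ x, |Q₁ x * periodicWindow P (x 2) ^ 2| ≤
      ε * (deriv (deriv H) (F x) * ‖gradient F x‖ ^ 2 * ψ x ^ 2 * periodicWindow P (x 2) ^ 2) +
        κ / ε * (H (F x) * ‖gradient ψ x‖ ^ 2 * periodicWindow P (x 2) ^ 2) := by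
    intro x
    have hw0 : 0 ≤ periodicWindow P (x 2) ^ 2 := sq_nonneg _
    rw [abs_mul, abs_of_nonneg hw0]
    have h1 : |Q₁ x| ≤ ε * (deriv (deriv H) (F x) * ‖gradient F x‖ ^ 2 * ψ x ^ 2) +
        κ / ε * (H (F x) * ‖gradient ψ x‖ ^ 2) := by
      simp only [hQ₁]
      rw [hgrad2 x, real_inner_smul_right, abs_mul, abs_mul]
      have hCS : |⟪gradient F x, gradient ψ x⟫| ≤ ‖gradient F x‖ * ‖gradient ψ x‖ :=
        abs_real_inner_le_norm _ _
      have hY := two_mul_abs_mul_mul_le (‖gradient F x‖ * |ψ x|) ‖gradient ψ x‖ hε hκ0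
        (hH0 (F x)) (hH2 (F x)) (hκ (F x))
      calc |deriv H (F x)| * (|2 * ψ x| * |⟪gradient F x, gradient ψ x⟫|)
          ≤ |deriv H (F x)| * (|2 * ψ x| * (‖gradient F x‖ * ‖gradient ψ x‖)) := by gcongr
        _ = 2 * |deriv H (F x)| * (‖gradient F x‖ * |ψ x|) * ‖gradient ψ x‖ := by
            rw [abs_mul, abs_two]; ring
        _ ≤ ε * deriv (deriv H) (F x) * (‖gradient F x‖ * |ψ x|) ^ 2 +
              κ / ε * H (F x) * ‖gradient ψ x‖ ^ 2 := hY
        _ = _ := by rw [mul_pow, sq_abs]; ring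
    have h2 := mul_le_mul_of_nonneg_right h1 hw0
    refine h2.trans (le_of_eq ?_)
    ring
  -- the right-hand sides as window integrals, then as slab integrals
  set R₁ : EuclideanSpace ℝ (Fin 3) → ℝ := fun x =>
    deriv (deriv H) (F x) * ‖gradient F x‖ ^ 2 * ψ x ^ 2 with hR₁
  set R₂ : EuclideanSpace ℝ (Fin 3) → ℝ := fun x => H (F x) * ‖gradient ψ x‖ ^ 2 with hR₂
  have hH'' : Continuous (deriv (deriv H)) := hH'.continuous_deriv le_rfl
  have hR₁c : Continuous R₁ := ((hH''.comp hF.continuous).mul (hgradF.norm.pow 2)).mul (hψ.continuous.pow 2)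
  have hgradψ : Continuous (gradient ψ) := continuous_gradient_of_contDiff hψ
  have hR₂c : Continuous R₂ := (hH.continuous.comp hF.continuous).mul (hgradψ.norm.pow 2)
  have hR₁0 : ∀ x, ρ ≤ cylRadius x → R₁ x = 0 := fun x hx => by simp only [hR₁, hψ0 x hx]; ring
  have hR₂0 : ∀ x, ρ + 1 ≤ cylRadius x → R₂ x = 0 := fun x hx => by
    simp only [hR₂, gradient_eq_zero_of_le_cylRadius_pse hψ0 hx, norm_zero]; ring
  have hg1 : IsAxiallyPeriodic P (gradient F) := periodic_of_eZ_pse fun x => by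
    simp only [gradient, periodic_apply_pse (periodic_fderiv_pse hFp)]
  have hgψ : IsAxiallyPeriodic P (gradient ψ) := periodic_of_eZ_pse fun x => by
    simp only [gradient, periodic_apply_pse (periodic_fderiv_pse hψp)]
  have hR₁p : IsAxiallyPeriodic P R₁ := periodic_of_eZ_pse fun x => by
    simp only [hR₁, periodic_apply_pse hFp, periodic_apply_pse hg1, periodic_apply_pse hψp]
  have hR₂p : IsAxiallyPeriodic P R₂ := periodic_of_eZ_pse fun x => by
    simp only [hR₂, periodic_apply_pse hFp, periodic_apply_pse hgψ]
  obtain ⟨hR₁w, -⟩ := integral_mul_window_sq_eq_and_deriv_eq_zero hP hR₁c hR₁p hR₁0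
  obtain ⟨hR₂w, -⟩ := integral_mul_window_sq_eq_and_deriv_eq_zero hP hR₂c hR₂p hR₂0
  have hiR₁ : Integrable (fun x => R₁ x * periodicWindow P (x 2) ^ 2)
      (volume : Measure (EuclideanSpace ℝ (Fin 3))) :=
    (hR₁c.mul (hW2c.comp hx2c)).integrable_of_hasCompactSupport
      (hasCompactSupport_mul_comp_apply_two (W := ω2) hR₁0 hW2)
  have hiR₂ : Integrable (fun x => R₂ x * periodicWindow P (x 2) ^ 2)
      (volume : Measure (EuclideanSpace ℝ (Fin 3))) :=
    (hR₂c.mul (hW2c.comp hx2c)).integrable_of_hasCompactSupport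
      (hasCompactSupport_mul_comp_apply_two (W := ω2) hR₂0 hW2)
  rw [← hR₁w, ← hR₂w]
  calc |∫ x, Q₁ x * periodicWindow P (x 2) ^ 2|
      ≤ ∫ x, |Q₁ x * periodicWindow P (x 2) ^ 2| := abs_integral_le_integral_abs
    _ ≤ ∫ x, (ε * (R₁ x * periodicWindow P (x 2) ^ 2) + κ / ε * (R₂ x * periodicWindow P (x 2) ^ 2)) := by
        refine integral_mono_of_nonneg (Eventually.of_forall fun x => abs_nonneg _)
          ((hiR₁.const_mul ε).add (hiR₂.const_mul (κ / ε))) (Eventually.of_forall fun x => ?_)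
        have h := hpt x
        simp only [hR₁, hR₂]
        refine h.trans (le_of_eq ?_)
        ring
    _ = ε * (∫ x, R₁ x * periodicWindow P (x 2) ^ 2) + κ / ε * ∫ x, R₂ x * periodicWindow P (x 2) ^ 2 := by
        rw [integral_add (hiR₁.const_mul ε) (hiR₂.const_mul (κ / ε)),
          MeasureTheory.integral_const_mul, MeasureTheory.integral_const_mul]

/-- **The drift term per period through the angular stream function** ((2.4)–(2.6):
"`−∬(b·∇)Λ²ψ_R² = ∬ v_rΛ²∂ᵣψ_R²` … `= ∬ −(L_θ(r,z,t) − L_θ(r,0,t))∂_zΛ²∂ᵣψ_R² ≤ C∬Λ²(∂ᵣψ_R)² + ⅛∬(∂_zΛ)²ψ_R²`",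
general convex `H`): for a divergence-free, axially periodic drift `b ∈ C¹` admitting a periodic
potential `Φ ∈ C¹` with `∂_zΦ = ⟪b, x_h⟫` and `|Φ| ≤ C_Φ r`, a `z`-independent cut-off `ψ` with
radial gradient `∇ψ = a x_h` vanishing off `{r < ρ}`, and axially periodic `F ∈ C²`,
`∫ H(F)⟪b, ∇φ̃²⟫ ≤ ε ∫_{slab} H″(F)‖∇F‖²ψ² + (κ C_Φ²/ε) ∫_{slab} H(F)‖∇ψ‖²`, `φ̃ = ψ ω(x₂)`. [cite: LeiRenZhang2019, §2 (2.4)–(2.6) (the drift term via the angular stream function L_θ), arXiv pp. 5–6] -/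
theorem drift_window_le (hP : 0 < P) (hF : ContDiff ℝ 2 F) (hFp : IsAxiallyPeriodic P F)
    {b : EuclideanSpace ℝ (Fin 3) → EuclideanSpace ℝ (Fin 3)} (hb1 : ContDiff ℝ 1 b)
    (hbp : IsAxiallyPeriodic P b)
    {Φ : EuclideanSpace ℝ (Fin 3) → ℝ} (hΦ1 : ContDiff ℝ 1 Φ) (hΦp : IsAxiallyPeriodic P Φ)
    (hΦz : ∀ x, fderiv ℝ Φ x eZ = ⟪b x, horizPart x⟫) {CΦ : ℝ} (hCΦ : 0 ≤ CΦ)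
    (hΦb : ∀ x, |Φ x| ≤ CΦ * cylRadius x)
    (hH : ContDiff ℝ 2 H) (hH0 : ∀ v, 0 ≤ H v) (hH2 : ∀ v, 0 ≤ deriv (deriv H) v) (hκ0 : 0 ≤ κ)
    (hκ : ∀ v, deriv H v ^ 2 ≤ κ * H v * deriv (deriv H) v)
    (hψ : ContDiff ℝ 1 ψ) (hψz : ∀ (x : EuclideanSpace ℝ (Fin 3)) (t : ℝ), ψ (x + t • eZ) = ψ x)
    (hψ0 : ∀ x, ρ ≤ cylRadius x → ψ x = 0)
    (ha : ContDiff ℝ 1 a) (haz : ∀ (x : EuclideanSpace ℝ (Fin 3)) (t : ℝ), a (x + t • eZ) = a x)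
    (hψg : ∀ x, gradient ψ x = a x • horizPart x) (hε : 0 < ε) :
    ∫ x, H (F x) * ⟪b x, gradient (fun y => (ψ y * periodicWindow P (y 2)) ^ 2) x⟫ ≤
      ε * (∫ x in zSlab P 0, deriv (deriv H) (F x) * ‖gradient F x‖ ^ 2 * ψ x ^ 2) +
        κ * CΦ ^ 2 / ε * ∫ x in zSlab P 0, H (F x) * ‖gradient ψ x‖ ^ 2 := by
  have hF1 : ContDiff ℝ 1 F := hF.of_le one_le_two
  have hH1 : ContDiff ℝ 1 H := hH.of_le one_le_two
  have hH' : ContDiff ℝ 1 (deriv H) := by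
    have h2 : ContDiff ℝ (1 + 1) H := by rw [one_add_one_eq_two]; exact hH
    exact h2.deriv'
  have hψp : IsAxiallyPeriodic P ψ := periodic_of_forall_add_smul_pse hψz
  have hap : IsAxiallyPeriodic P a := periodic_of_forall_add_smul_pse haz
  set ω2 : ℝ → ℝ := fun z => periodicWindow P z ^ 2 with hω2
  have hW2 : ∀ z, ω2 z ≠ 0 → |z| ≤ 2 * P := fun z hz => abs_le_of_periodicWindow_sq_ne_zero_pse hP z hz
  have hW2C : ContDiff ℝ 1 ω2 := contDiff_periodicWindow_sq P (n := 1)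
  have hW2c : Continuous ω2 := hW2C.continuous
  have hW2' : Continuous (deriv ω2) := hW2C.continuous_deriv le_rfl
  have hW2'cs : HasCompactSupport (deriv ω2) := (hasCompactSupport_periodicWindow_sq hP).deriv
  obtain ⟨A, hA⟩ : ∃ A : ℝ, ∀ z, deriv ω2 z ≠ 0 → |z| ≤ A := by
    obtain ⟨A, hA⟩ := (hW2'cs.isCompact.isBounded).subset_closedBall 0
    exact ⟨A, fun z hz => by
      have := hA (subset_tsupport _ (mem_support.2 hz))
      rwa [mem_closedBall_zero_iff, Real.norm_eq_abs] at this⟩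
  have hx2c : Continuous fun x : EuclideanSpace ℝ (Fin 3) => x 2 :=
    (EuclideanSpace.proj (𝕜 := ℝ) (2 : Fin 3)).continuous
  -- `⟪b, ∇φ̃²⟫ = 2ψ a ∂_zΦ ω² + ψ² b_z (ω²)'`
  have hgrad2 : ∀ x, gradient (fun y => ψ y ^ 2) x = (2 * ψ x) • gradient ψ x := fun x =>
    gradient_sq_pse ((hψ.differentiable one_ne_zero) x)
  -- the `C¹` coefficient `c = 2ψa`
  set c : EuclideanSpace ℝ (Fin 3) → ℝ := fun x => 2 * ψ x * a x with hc
  have hc1 : ContDiff ℝ 1 c := (contDiff_const.mul hψ).mul ha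
  have hcz : ∀ (x : EuclideanSpace ℝ (Fin 3)) (t : ℝ), c (x + t • eZ) = c x := fun x t => by
    simp only [hc, hψz, haz]
  have hsplit : ∀ x, H (F x) * ⟪b x, gradient (fun y => (ψ y * periodicWindow P (y 2)) ^ 2) x⟫ =
      fderiv ℝ Φ x eZ * (c x * H (F x) * ω2 (x 2)) +
        (H (F x) * ψ x ^ 2 * (b x) 2) * deriv ω2 (x 2) := by
    intro x
    rw [gradient_windowCutoff_sq P hψ x, inner_add_right, real_inner_smul_right, real_inner_smul_right,
      hgrad2 x, real_inner_smul_right, hψg x, real_inner_smul_right, ← hΦz x]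
    have : ⟪b x, (eZ : EuclideanSpace ℝ (Fin 3))⟫ = (b x) 2 := by
      simp [PiLp.inner_apply, eZ]
    rw [this]
    simp only [hc, hω2]
    ring
  -- the `(ω²)'`-junk term vanishes
  set Q₂ : EuclideanSpace ℝ (Fin 3) → ℝ := fun x => H (F x) * ψ x ^ 2 * (b x) 2 with hQ₂
  have hb2c : Continuous fun x => (b x) 2 := (EuclideanSpace.proj (𝕜 := ℝ) (2 : Fin 3)).continuous.comp hb1.continuous
  have hHFc : Continuous fun x => H (F x) := hH.continuous.comp hF.continuous
  have hQ₂c : Continuous Q₂ := (hHFc.mul (hψ.continuous.pow 2)).mul hb2c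
  have hQ₂0 : ∀ x, ρ ≤ cylRadius x → Q₂ x = 0 := fun x hx => by simp only [hQ₂, hψ0 x hx]; ring
  have hQ₂p : IsAxiallyPeriodic P Q₂ := periodic_of_eZ_pse fun x => by
    simp only [hQ₂, periodic_apply_pse hFp, periodic_apply_pse hψp, periodic_apply_pse hbp]
  obtain ⟨-, hQ₂zero⟩ := integral_mul_window_sq_eq_and_deriv_eq_zero hP hQ₂c hQ₂p hQ₂0
  -- the main term: integrate by parts in `z`
  set Θ : EuclideanSpace ℝ (Fin 3) → ℝ := fun x => c x * H (F x) * ω2 (x 2) with hΘ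
  have hcH1 : ContDiff ℝ 1 fun x => c x * H (F x) := hc1.mul (hH1.comp hF1)
  have hΘ1 : ContDiff ℝ 1 Θ := contDiff_mul_comp_apply_two hcH1 hW2C
  have hc0 : ∀ x, ρ ≤ cylRadius x → c x = 0 := fun x hx => by simp only [hc, hψ0 x hx]; ring
  have hcH0 : ∀ x, ρ ≤ cylRadius x → c x * H (F x) = 0 := fun x hx => by rw [hc0 x hx, zero_mul]
  have hΘc : HasCompactSupport Θ := hasCompactSupport_mul_comp_apply_two (W := ω2) hcH0 hW2
  -- `∂_z Θ = c H'(F) ∂_zF ω² + c H(F) (ω²)'`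
  have hΘz : ∀ x, fderiv ℝ Θ x eZ =
      c x * (deriv H (F x) * fderiv ℝ F x eZ) * ω2 (x 2) + c x * H (F x) * deriv ω2 (x 2) := by
    intro x
    have hcd : DifferentiableAt ℝ c x := (hc1.differentiable one_ne_zero) x
    have hHFd : DifferentiableAt ℝ (fun y => H (F y)) x := ((hH1.comp hF1).differentiable one_ne_zero) x
    have hcHd : DifferentiableAt ℝ (fun y => c y * H (F y)) x := hcd.mul hHFd
    have hW2d : DifferentiableAt ℝ ω2 (x 2) := (hW2C.differentiable one_ne_zero) _
    rw [show Θ = fun y => (fun y => c y * H (F y)) y * ω2 (y 2) from rfl,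
      fderiv_mul_comp_apply_two hcHd hW2d, fderiv_fun_mul hcd hHFd]
    have hcz0 : fderiv ℝ c x eZ = 0 := fderiv_eZ_eq_zero_of_forall_add_smul_pse hcd (hcz x)
    have hd : fderiv ℝ (fun y => H (F y)) x = deriv H (F x) • fderiv ℝ F x :=
      ((((hH.differentiable two_ne_zero) (F x)).hasDerivAt).comp_hasFDerivAt x
        ((hF.differentiable two_ne_zero) x).hasFDerivAt).fderiv
    simp only [_root_.add_apply, FunLike.coe_smul, Pi.smul_apply, smul_eq_mul, hd, hcz0, mul_zero,
      add_zero]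
    simp only [eZ, PiLp.single_apply, if_true, mul_one]
    ring
  -- `∫ ∂_z(ΦΘ) = 0`
  have hprod1 : ContDiff ℝ 1 fun x => Φ x * Θ x := hΦ1.mul hΘ1
  have hprodc : HasCompactSupport fun x => Φ x * Θ x := hΘc.mul_left
  have hIBP := integral_fderiv_apply_eq_zero hprod1 hprodc eZ
  have hprodz : ∀ x, fderiv ℝ (fun y => Φ y * Θ y) x eZ =
      fderiv ℝ Φ x eZ * Θ x + Φ x * fderiv ℝ Θ x eZ := by
    intro x
    rw [fderiv_fun_mul ((hΦ1.differentiable one_ne_zero) x) ((hΘ1.differentiable one_ne_zero) x)]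
    simp only [_root_.add_apply, FunLike.coe_smul, Pi.smul_apply, smul_eq_mul]
    ring
  simp_rw [hprodz] at hIBP
  -- integrability of the two products
  have hΘcont : Continuous Θ := hΘ1.continuous
  have hΘzc : Continuous fun x => fderiv ℝ Θ x eZ := (hΘ1.continuous_fderiv one_ne_zero).clm_apply continuous_const
  have hΦzc : Continuous fun x => fderiv ℝ Φ x eZ := (hΦ1.continuous_fderiv one_ne_zero).clm_apply continuous_const
  have hΘzcs : HasCompactSupport fun x => fderiv ℝ Θ x eZ := hΘc.fderiv_apply (𝕜 := ℝ) eZ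
  have hiA : Integrable (fun x => fderiv ℝ Φ x eZ * Θ x) (volume : Measure (EuclideanSpace ℝ (Fin 3))) :=
    (hΦzc.mul hΘcont).integrable_of_hasCompactSupport hΘc.mul_left
  have hiB : Integrable (fun x => Φ x * fderiv ℝ Θ x eZ) (volume : Measure (EuclideanSpace ℝ (Fin 3))) :=
    (hΦ1.continuous.mul hΘzc).integrable_of_hasCompactSupport hΘzcs.mul_left
  rw [integral_add hiA hiB] at hIBP
  -- the second junk term `∫ Φ c H(F) (ω²)' = 0`
  set Q₃ : EuclideanSpace ℝ (Fin 3) → ℝ := fun x => Φ x * (c x * H (F x)) with hQ₃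
  have hQ₃c : Continuous Q₃ := hΦ1.continuous.mul hcH1.continuous
  have hQ₃0 : ∀ x, ρ ≤ cylRadius x → Q₃ x = 0 := fun x hx => by simp only [hQ₃, hcH0 x hx, mul_zero]
  have hcp : IsAxiallyPeriodic P c := periodic_of_forall_add_smul_pse hcz
  have hQ₃p : IsAxiallyPeriodic P Q₃ := periodic_of_eZ_pse fun x => by
    simp only [hQ₃, periodic_apply_pse hΦp, periodic_apply_pse hcp, periodic_apply_pse hFp]
  obtain ⟨-, hQ₃zero⟩ := integral_mul_window_sq_eq_and_deriv_eq_zero hP hQ₃c hQ₃p hQ₃0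
  -- the main term after integration by parts
  set Mn : EuclideanSpace ℝ (Fin 3) → ℝ := fun x =>
    Φ x * (c x * (deriv H (F x) * fderiv ℝ F x eZ)) * ω2 (x 2) with hMn
  have hHFc' : Continuous fun x => deriv H (F x) := (hH.continuous_deriv (by norm_num)).comp hF.continuous
  have hFz : Continuous fun x => fderiv ℝ F x eZ := (hF.continuous_fderiv (by norm_num)).clm_apply continuous_const
  have hMn0 : ∀ x, ρ ≤ cylRadius x → Φ x * (c x * (deriv H (F x) * fderiv ℝ F x eZ)) = 0 := fun x hx => by
    rw [hc0 x hx]; ring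
  have hiMn : Integrable Mn (volume : Measure (EuclideanSpace ℝ (Fin 3))) :=
    ((hΦ1.continuous.mul (hc1.continuous.mul (hHFc'.mul hFz))).mul (hW2c.comp hx2c)).integrable_of_hasCompactSupport
      (hasCompactSupport_mul_comp_apply_two (W := ω2) hMn0 hW2)
  have hiQ₃ : Integrable (fun x => Q₃ x * deriv ω2 (x 2)) (volume : Measure (EuclideanSpace ℝ (Fin 3))) :=
    (hQ₃c.mul (hW2'.comp hx2c)).integrable_of_hasCompactSupport
      (hasCompactSupport_mul_comp_apply_two (W := deriv ω2) hQ₃0 hA)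
  have hBsplit : ∫ x, Φ x * fderiv ℝ Θ x eZ = (∫ x, Mn x) + ∫ x, Q₃ x * deriv ω2 (x 2) := by
    rw [← integral_add hiMn hiQ₃]
    refine integral_congr_ae (Eventually.of_forall fun x => ?_)
    simp only [hΘz x, hMn, hQ₃]
    ring
  rw [hBsplit, hQ₃zero, add_zero] at hIBP
  -- so `∫ ∂_zΦ Θ = −∫ Mn`
  have hmain : ∫ x, fderiv ℝ Φ x eZ * Θ x = -∫ x, Mn x := by linarith
  -- assemble the left-hand side
  have hi2 : Integrable (fun x => Q₂ x * deriv ω2 (x 2)) (volume : Measure (EuclideanSpace ℝ (Fin 3))) :=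
    (hQ₂c.mul (hW2'.comp hx2c)).integrable_of_hasCompactSupport
      (hasCompactSupport_mul_comp_apply_two (W := deriv ω2) hQ₂0 hA)
  have hLHS : ∫ x, H (F x) * ⟪b x, gradient (fun y => (ψ y * periodicWindow P (y 2)) ^ 2) x⟫ =
      -∫ x, Mn x := by
    simp_rw [hsplit]
    rw [integral_add hiA hi2, hQ₂zero, add_zero, hmain]
  rw [hLHS]
  -- pointwise Young on `Mn`
  have hpt : ∀ x, |Mn x| ≤
      ε * (deriv (deriv H) (F x) * ‖gradient F x‖ ^ 2 * ψ x ^ 2 * ω2 (x 2)) +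
        κ * CΦ ^ 2 / ε * (H (F x) * ‖gradient ψ x‖ ^ 2 * ω2 (x 2)) := by
    intro x
    have hw0 : 0 ≤ ω2 (x 2) := sq_nonneg _
    have hΦc : |Φ x * c x| ≤ 2 * |ψ x| * (CΦ * ‖gradient ψ x‖) := by
      rw [hψg x, norm_smul_horizPart, abs_mul]
      simp only [hc, abs_mul, abs_two]
      have h1 := hΦb x
      have h2 : 0 ≤ |a x| := abs_nonneg _
      have h3 : 0 ≤ |ψ x| := abs_nonneg _
      calc |Φ x| * (2 * |ψ x| * |a x|) ≤ CΦ * cylRadius x * (2 * |ψ x| * |a x|) := by gcongr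
        _ = 2 * |ψ x| * (CΦ * (|a x| * cylRadius x)) := by ring
        _ ≤ 2 * |ψ x| * (CΦ * (|a x| * cylRadius x)) := le_rfl
    have hFz' : |fderiv ℝ F x eZ| ≤ ‖gradient F x‖ := abs_fderiv_eZ_le_norm_gradient_pse F x
    have hY := two_mul_abs_mul_mul_le (‖gradient F x‖ * |ψ x|) (CΦ * ‖gradient ψ x‖) hε hκ0
      (hH0 (F x)) (hH2 (F x)) (hκ (F x))
    have hMn_abs : |Mn x| = |Φ x * c x| * |deriv H (F x)| * |fderiv ℝ F x eZ| * ω2 (x 2) := by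
      simp only [hMn, abs_mul, abs_of_nonneg hw0]
      ring
    rw [hMn_abs]
    have hstep : |Φ x * c x| * |deriv H (F x)| * |fderiv ℝ F x eZ| ≤
        2 * |deriv H (F x)| * (‖gradient F x‖ * |ψ x|) * (CΦ * ‖gradient ψ x‖) := by
      have h4 : 0 ≤ |deriv H (F x)| := abs_nonneg _
      calc |Φ x * c x| * |deriv H (F x)| * |fderiv ℝ F x eZ|
          ≤ (2 * |ψ x| * (CΦ * ‖gradient ψ x‖)) * |deriv H (F x)| * ‖gradient F x‖ := by
            gcongr
        _ = 2 * |deriv H (F x)| * (‖gradient F x‖ * |ψ x|) * (CΦ * ‖gradient ψ x‖) := by ring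
    calc |Φ x * c x| * |deriv H (F x)| * |fderiv ℝ F x eZ| * ω2 (x 2)
        ≤ (2 * |deriv H (F x)| * (‖gradient F x‖ * |ψ x|) * (CΦ * ‖gradient ψ x‖)) * ω2 (x 2) :=
          mul_le_mul_of_nonneg_right hstep hw0
      _ ≤ (ε * deriv (deriv H) (F x) * (‖gradient F x‖ * |ψ x|) ^ 2 +
            κ / ε * H (F x) * (CΦ * ‖gradient ψ x‖) ^ 2) * ω2 (x 2) :=
          mul_le_mul_of_nonneg_right hY hw0
      _ = _ := by rw [mul_pow, mul_pow, sq_abs]; ring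
  -- the right-hand sides as window integrals, then as slab integrals
  set R₁ : EuclideanSpace ℝ (Fin 3) → ℝ := fun x =>
    deriv (deriv H) (F x) * ‖gradient F x‖ ^ 2 * ψ x ^ 2 with hR₁
  set R₂ : EuclideanSpace ℝ (Fin 3) → ℝ := fun x => H (F x) * ‖gradient ψ x‖ ^ 2 with hR₂
  have hH'' : Continuous (deriv (deriv H)) := hH'.continuous_deriv le_rfl
  have hgradF : Continuous (gradient F) := continuous_gradient_of_contDiff hF1
  have hR₁c : Continuous R₁ := ((hH''.comp hF.continuous).mul (hgradF.norm.pow 2)).mul (hψ.continuous.pow 2)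
  have hgradψ : Continuous (gradient ψ) := continuous_gradient_of_contDiff hψ
  have hR₂c : Continuous R₂ := (hH.continuous.comp hF.continuous).mul (hgradψ.norm.pow 2)
  have hR₁0 : ∀ x, ρ ≤ cylRadius x → R₁ x = 0 := fun x hx => by simp only [hR₁, hψ0 x hx]; ring
  have hR₂0 : ∀ x, ρ + 1 ≤ cylRadius x → R₂ x = 0 := fun x hx => by
    simp only [hR₂, gradient_eq_zero_of_le_cylRadius_pse hψ0 hx, norm_zero]; ring
  have hg1 : IsAxiallyPeriodic P (gradient F) := periodic_of_eZ_pse fun x => by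
    simp only [gradient, periodic_apply_pse (periodic_fderiv_pse hFp)]
  have hgψ : IsAxiallyPeriodic P (gradient ψ) := periodic_of_eZ_pse fun x => by
    simp only [gradient, periodic_apply_pse (periodic_fderiv_pse hψp)]
  have hR₁p : IsAxiallyPeriodic P R₁ := periodic_of_eZ_pse fun x => by
    simp only [hR₁, periodic_apply_pse hFp, periodic_apply_pse hg1, periodic_apply_pse hψp]
  have hR₂p : IsAxiallyPeriodic P R₂ := periodic_of_eZ_pse fun x => by
    simp only [hR₂, periodic_apply_pse hFp, periodic_apply_pse hgψ]
  obtain ⟨hR₁w, -⟩ := integral_mul_window_sq_eq_and_deriv_eq_zero hP hR₁c hR₁p hR₁0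
  obtain ⟨hR₂w, -⟩ := integral_mul_window_sq_eq_and_deriv_eq_zero hP hR₂c hR₂p hR₂0
  have hiR₁ : Integrable (fun x => R₁ x * periodicWindow P (x 2) ^ 2)
      (volume : Measure (EuclideanSpace ℝ (Fin 3))) :=
    (hR₁c.mul (hW2c.comp hx2c)).integrable_of_hasCompactSupport
      (hasCompactSupport_mul_comp_apply_two (W := ω2) hR₁0 hW2)
  have hiR₂ : Integrable (fun x => R₂ x * periodicWindow P (x 2) ^ 2)
      (volume : Measure (EuclideanSpace ℝ (Fin 3))) :=
    (hR₂c.mul (hW2c.comp hx2c)).integrable_of_hasCompactSupport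
      (hasCompactSupport_mul_comp_apply_two (W := ω2) hR₂0 hW2)
  rw [← hR₁w, ← hR₂w]
  calc -∫ x, Mn x ≤ |∫ x, Mn x| := neg_le_abs _
    _ ≤ ∫ x, |Mn x| := abs_integral_le_integral_abs
    _ ≤ ∫ x, (ε * (R₁ x * periodicWindow P (x 2) ^ 2) + κ * CΦ ^ 2 / ε * (R₂ x * periodicWindow P (x 2) ^ 2)) := by
        refine integral_mono_of_nonneg (Eventually.of_forall fun x => abs_nonneg _)
          ((hiR₁.const_mul ε).add (hiR₂.const_mul (κ * CΦ ^ 2 / ε))) (Eventually.of_forall fun x => ?_)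
        have h := hpt x
        simp only [hR₁, hR₂, hω2] at h ⊢
        refine h.trans (le_of_eq ?_)
        ring
    _ = ε * (∫ x, R₁ x * periodicWindow P (x 2) ^ 2) +
          κ * CΦ ^ 2 / ε * ∫ x, R₂ x * periodicWindow P (x 2) ^ 2 := by
        rw [integral_add (hiR₁.const_mul ε) (hiR₂.const_mul (κ * CΦ ^ 2 / ε)),
          MeasureTheory.integral_const_mul, MeasureTheory.integral_const_mul]

end CutoffTerms

/-! ### The energy inequality per period ((2.8) before Sobolev) -/

section Energy

variable {P : ℝ} {ψ a : EuclideanSpace ℝ (Fin 3) → ℝ} {ρ CΦ : ℝ} {H : ℝ → ℝ} {κ ε : ℝ}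

/-- `φ̃ = ψ ω(x₂)` is radially non-increasing when `ψ` is: `φ̃ ∂ᵣφ̃ = ω² ψ ∂ᵣψ ≤ 0`. [cite: LeiRenZhang2019, §2 (2.7) (the axis term (2/r)∂ᵣψ_R² on D_R), arXiv p. 6] -/
theorem windowCutoff_mul_fderiv_eR_nonpos (P : ℝ) (hψ : ContDiff ℝ 1 ψ)
    (hψr : ∀ x, ψ x * fderiv ℝ ψ x (eR x) ≤ 0) (x : EuclideanSpace ℝ (Fin 3)) :
    (ψ x * periodicWindow P (x 2)) *
        fderiv ℝ (fun y => ψ y * periodicWindow P (y 2)) x (eR x) ≤ 0 := by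
  rw [fderiv_mul_comp_apply_two_eR ((hψ.differentiable one_ne_zero) x)
    (((contDiff_periodicWindow P (n := 1)).differentiable one_ne_zero) _)]
  have h := hψr x
  have hw : 0 ≤ periodicWindow P (x 2) ^ 2 := sq_nonneg _
  nlinarith

/-- **The per-period mass as a window integral**: `∫ H(F) φ̃² = ∫_{slab} H(F) ψ²` for axially
periodic `F` and the `z`-independent cut-off `ψ` (`φ̃ = ψ ω(x₂)`, `Σ_k ω(· + kP)² = 1`). [cite: LeiRenZhang2019, §2 (2.8) (the term sup_t ‖(Λφ_R)(·,t)‖²_{L²} over one period), arXiv p. 6] -/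
theorem integral_comp_mul_windowSq_eq (hP : 0 < P) {F : EuclideanSpace ℝ (Fin 3) → ℝ}
    (hF : Continuous F) (hFp : IsAxiallyPeriodic P F) (hHc : Continuous H) (hψ : Continuous ψ)
    (hψz : ∀ (x : EuclideanSpace ℝ (Fin 3)) (t : ℝ), ψ (x + t • eZ) = ψ x)
    (hψ0 : ∀ x, ρ ≤ cylRadius x → ψ x = 0) :
    ∫ x, H (F x) * (ψ x * periodicWindow P (x 2)) ^ 2 = ∫ x in zSlab P 0, H (F x) * ψ x ^ 2 := by
  have hψp : IsAxiallyPeriodic P ψ := periodic_of_forall_add_smul_pse hψz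
  set Q : EuclideanSpace ℝ (Fin 3) → ℝ := fun x => H (F x) * ψ x ^ 2 with hQ
  have hQc : Continuous Q := (hHc.comp hF).mul (hψ.pow 2)
  have hQ0 : ∀ x, ρ ≤ cylRadius x → Q x = 0 := fun x hx => by simp only [hQ, hψ0 x hx]; ring
  have hQp : IsAxiallyPeriodic P Q := periodic_of_eZ_pse fun x => by
    simp only [hQ, periodic_apply_pse hFp, periodic_apply_pse hψp]
  obtain ⟨h, -⟩ := integral_mul_window_sq_eq_and_deriv_eq_zero hP hQc hQp hQ0
  rw [← h]
  refine integral_congr_ae (Eventually.of_forall fun x => ?_)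
  simp only [hQ]
  ring

/-- **The tested equation per period, estimated** ((2.3)–(2.7) assembled; general convex `H`
with `H'² ≤ κHH″`): for the slice data of `integral_deriv_comp_mul_rhs_mul_sq_eq` with `F`, `b`
axially periodic, `b` admitting the periodic potential `Φ` (`∂_zΦ = ⟪b, x_h⟫`, `|Φ| ≤ C_Φ r`),
and the cut-off `φ̃ = ψ ω(x₂)` with `ψ` `z`-independent, radially non-increasing, `∇ψ = a x_h`,
`∫ H'(F)(ΔF − DF[b] − (2/r)∂ᵣF) φ̃² ≤ −(1 − 2ε) ∫_{slab} H″(F)‖∇F‖²ψ² + (κ/ε)(1 + C_Φ²) ∫_{slab} H(F)‖∇ψ‖²`. [cite: LeiRenZhang2019, §2 (2.3)–(2.8) (proof of Lemma 2.1, the energy estimate per period), arXiv pp. 5–6] -/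
theorem integral_deriv_comp_mul_rhs_mul_windowSq_le (hP : 0 < P)
    {F : EuclideanSpace ℝ (Fin 3) → ℝ} {b : EuclideanSpace ℝ (Fin 3) → EuclideanSpace ℝ (Fin 3)}
    {Φ : EuclideanSpace ℝ (Fin 3) → ℝ}
    (hF2 : ContDiff ℝ 2 F) (hFa : IsAxisymmetricScalar F) (hF0 : ∀ x, cylRadius x = 0 → F x = 0)
    (hFp : IsAxiallyPeriodic P F)
    (hb1 : ContDiff ℝ 1 b) (hbdiv : ∀ x, VectorCalculus.divergence b x = 0) (hbp : IsAxiallyPeriodic P b)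
    (hΦ1 : ContDiff ℝ 1 Φ) (hΦp : IsAxiallyPeriodic P Φ) (hΦz : ∀ x, fderiv ℝ Φ x eZ = ⟪b x, horizPart x⟫)
    (hCΦ : 0 ≤ CΦ) (hΦb : ∀ x, |Φ x| ≤ CΦ * cylRadius x)
    (hH : ContDiff ℝ 2 H) (hH00 : H 0 = 0) (hH0 : ∀ v, 0 ≤ H v) (hH2 : ∀ v, 0 ≤ deriv (deriv H) v)
    (hκ0 : 0 ≤ κ) (hκ : ∀ v, deriv H v ^ 2 ≤ κ * H v * deriv (deriv H) v)
    (hψ : ContDiff ℝ 2 ψ) (hψa : IsAxisymmetricScalar ψ)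
    (hψz : ∀ (x : EuclideanSpace ℝ (Fin 3)) (t : ℝ), ψ (x + t • eZ) = ψ x)
    (hψ0 : ∀ x, ρ ≤ cylRadius x → ψ x = 0) (hψr : ∀ x, ψ x * fderiv ℝ ψ x (eR x) ≤ 0)
    (ha : ContDiff ℝ 1 a) (haz : ∀ (x : EuclideanSpace ℝ (Fin 3)) (t : ℝ), a (x + t • eZ) = a x)
    (hψg : ∀ x, gradient ψ x = a x • horizPart x) (hε : 0 < ε) :
    ∫ x, deriv H (F x) * ((Δ F) x - fderiv ℝ F x (b x) - 2 / cylRadius x * fderiv ℝ F x (eR x)) *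
        (ψ x * periodicWindow P (x 2)) ^ 2 ≤
      -(1 - 2 * ε) * (∫ x in zSlab P 0, deriv (deriv H) (F x) * ‖gradient F x‖ ^ 2 * ψ x ^ 2) +
        κ / ε * (1 + CΦ ^ 2) * ∫ x in zSlab P 0, H (F x) * ‖gradient ψ x‖ ^ 2 := by
  have hψ1 : ContDiff ℝ 1 ψ := hψ.of_le one_le_two
  -- the whole-space cut-off `φ̃`
  obtain ⟨φt, hφt⟩ : ∃ φt : EuclideanSpace ℝ (Fin 3) → ℝ, φt = fun y => ψ y * periodicWindow P (y 2) :=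
    ⟨_, rfl⟩
  have hW : ∀ z, periodicWindow P z ≠ 0 → |z| ≤ 2 * P := fun z hz =>
    abs_le_of_periodicWindow_ne_zero_pse hP z hz
  have hφt2 : ContDiff ℝ 2 φt := by rw [hφt]; exact contDiff_mul_comp_apply_two hψ (contDiff_periodicWindow P)
  have hφtc : HasCompactSupport φt := by rw [hφt]; exact hasCompactSupport_mul_comp_apply_two hψ0 hW
  have hφta : IsAxisymmetricScalar φt := by rw [hφt]; exact isAxisymmetricScalar_mul_comp_apply_two hψa _
  have hφtr : ∀ x, φt x * fderiv ℝ φt x (eR x) ≤ 0 := by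
    rw [hφt]; exact windowCutoff_mul_fderiv_eR_nonpos P hψ1 hψr
  -- the slice identity with `φ̃`
  obtain ⟨-, hid⟩ := integral_deriv_comp_mul_rhs_mul_sq_eq hF2 hFa hF0 hb1 hbdiv hH hH00 hφt2 hφtc hφta
  -- the axis term has a sign
  have h3 : ∫ x, 2 / cylRadius x * (H (F x) * fderiv ℝ (fun y => φt y ^ 2) x (eR x)) ≤ 0 :=
    integral_axis_term_nonpos (F := F) hH0 (hφt2.differentiable two_ne_zero) hφtr
  -- split the viscous term
  have hH' : ContDiff ℝ 1 (deriv H) := by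
    have h2 : ContDiff ℝ (1 + 1) H := by rw [one_add_one_eq_two]; exact hH
    exact h2.deriv'
  have hH'' : Continuous (deriv (deriv H)) := hH'.continuous_deriv le_rfl
  have hφt2c : HasCompactSupport fun y => φt y ^ 2 :=
    hφtc.comp_left (g := fun t : ℝ => t ^ 2) (by simp)
  have hgradφt2 : Continuous (gradient fun y => φt y ^ 2) :=
    continuous_gradient_of_contDiff ((hφt2.pow 2).of_le (by norm_num))
  have hgradφt2c : HasCompactSupport (gradient fun y => φt y ^ 2) :=
    HasCompactSupport.intro hφt2c fun x hx => gradient_eq_zero_of_notMem_tsupport hx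
  have hgradF : Continuous (gradient F) := continuous_gradient_of_contDiff (hF2.of_le one_le_two)
  have hiG : Integrable (fun x => deriv (deriv H) (F x) * ‖gradient F x‖ ^ 2 * φt x ^ 2)
      (volume : Measure (EuclideanSpace ℝ (Fin 3))) :=
    (((hH''.comp hF2.continuous).mul (hgradF.norm.pow 2)).mul
      (hφt2.continuous.pow 2)).integrable_of_hasCompactSupport hφt2c.mul_left
  have hiT : Integrable (fun x => deriv H (F x) * ⟪gradient F x, gradient (fun y => φt y ^ 2) x⟫)
      (volume : Measure (EuclideanSpace ℝ (Fin 3))) :=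
    (((hH.continuous_deriv (by norm_num)).comp hF2.continuous).mul
      (hgradF.inner hgradφt2)).integrable_of_hasCompactSupport
        (hgradφt2c.mono fun x hx => by
          contrapose! hx
          simp only [mem_support, not_not] at hx ⊢
          simp only [Pi.mul_apply, Function.comp_apply, hx, inner_zero_right, mul_zero])
  rw [integral_add hiG hiT] at hid
  -- the good term is the slab functional `G`
  have hGω : ∫ x, deriv (deriv H) (F x) * ‖gradient F x‖ ^ 2 * φt x ^ 2 =
      ∫ x in zSlab P 0, deriv (deriv H) (F x) * ‖gradient F x‖ ^ 2 * ψ x ^ 2 := by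
    have hψp : IsAxiallyPeriodic P ψ := periodic_of_forall_add_smul_pse hψz
    set Q : EuclideanSpace ℝ (Fin 3) → ℝ := fun x =>
      deriv (deriv H) (F x) * ‖gradient F x‖ ^ 2 * ψ x ^ 2 with hQ
    have hQc : Continuous Q := ((hH''.comp hF2.continuous).mul (hgradF.norm.pow 2)).mul (hψ.continuous.pow 2)
    have hQ0 : ∀ x, ρ ≤ cylRadius x → Q x = 0 := fun x hx => by simp only [hQ, hψ0 x hx]; ring
    have hg1 : IsAxiallyPeriodic P (gradient F) := periodic_of_eZ_pse fun x => by
      simp only [gradient, periodic_apply_pse (periodic_fderiv_pse hFp)]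
    have hQp : IsAxiallyPeriodic P Q := periodic_of_eZ_pse fun x => by
      simp only [hQ, periodic_apply_pse hFp, periodic_apply_pse hg1, periodic_apply_pse hψp]
    obtain ⟨h, -⟩ := integral_mul_window_sq_eq_and_deriv_eq_zero hP hQc hQp hQ0
    rw [← h]
    refine integral_congr_ae (Eventually.of_forall fun x => ?_)
    simp only [hQ, hφt]
    ring
  -- the two cut-off terms
  have h1 := abs_viscousCutoff_window_le hP hF2 hFp hH hH0 hH2 hκ0 hκ hψ1 hψz hψ0 hε
  have h2 := drift_window_le hP hF2 hFp hb1 hbp hΦ1 hΦp hΦz hCΦ hΦb hH hH0 hH2 hκ0 hκ hψ1 hψz hψ0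
    ha haz hψg hε
  -- put everything in the `φ̃`-form of the identity
  have hφt2eq : (fun y => φt y ^ 2) = fun y => (ψ y * periodicWindow P (y 2)) ^ 2 := by
    funext y; rw [hφt]
  rw [hφt2eq] at hid h3
  have hLHS : ∫ x, deriv H (F x) * ((Δ F) x - fderiv ℝ F x (b x) - 2 / cylRadius x * fderiv ℝ F x (eR x)) *
      (ψ x * periodicWindow P (x 2)) ^ 2 =
      ∫ x, deriv H (F x) * ((Δ F) x - fderiv ℝ F x (b x) - 2 / cylRadius x * fderiv ℝ F x (eR x)) *
        φt x ^ 2 := by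
    simp only [hφt]
  rw [hLHS, hid, hGω]
  have hT₁ := neg_le_abs (∫ x, deriv H (F x) *
    ⟪gradient F x, gradient (fun y => (ψ y * periodicWindow P (y 2)) ^ 2) x⟫)
  have hsplitc : κ / ε * (1 + CΦ ^ 2) * ∫ x in zSlab P 0, H (F x) * ‖gradient ψ x‖ ^ 2 =
      κ / ε * (∫ x in zSlab P 0, H (F x) * ‖gradient ψ x‖ ^ 2) +
        κ * CΦ ^ 2 / ε * ∫ x in zSlab P 0, H (F x) * ‖gradient ψ x‖ ^ 2 := by ring
  rw [hsplitc]
  linarith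

/-- **The energy inequality per period (Lei–Ren–Zhang 2019, (2.8)) in time-integrated form.**
Setting: on `[t₁, t₂]`, axisymmetric `F(s,·) ∈ C²` vanishing on the axis and axially `P`-periodic;
a `C¹` divergence-free axially periodic drift `b(s,·)` admitting periodic potentials
`Φ(s,·) ∈ C¹` with `∂_zΦ = ⟪b, x_h⟫ = r b_r` and `|Φ| ≤ C_Φ r` (the angular stream function:
`v_r = −∂_zL_θ`, `|L_θ(r,z,t) − L_θ(r,0,t)| ≤ Z₀ sup|v_r|`); the equation in time-integrated form
`F(s,x) = F(t₁,x) + ∫_{t₁}^s N`, `N = ΔF − DF[b] − (2/r)∂ᵣF`, for a.e. `x`; a convex `H ∈ C²`,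
`H ≥ 0`, `H(0) = 0`, `H'² ≤ κHH″`; a `z`-independent radially non-increasing cut-off `ψ ∈ C²`
vanishing off `{r < ρ}` with radial gradient `∇ψ = a x_h`; a time cut-off `η ∈ C¹`, `η ≥ 0`,
`η(t₁) = 0`; `ε > 0`; the space–time integrability of the equation tested against
`φ̃² = ψ²ω(x₂)²`; and the slab functionals `G(s) = ∫_{slab} H″(F)‖∇F‖²ψ²`,
`M(s) = ∫_{slab} H(F)ψ²`, `P_ψ(s) = ∫_{slab} H(F)‖∇ψ‖²` integrable in time. Then
`η(t₂)M(t₂) + (1 − 2ε)∫_{t₁}^{t₂} ηG ≤ ∫_{t₁}^{t₂} (η (κ/ε)(1 + C_Φ²) P_ψ + |η′| M)`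
— the form "`sup_t ‖Λφ_R‖²_{L²} + ‖∇(Λψ_R)‖²_{L²L²} ≤ C(σ₁−σ₂)⁻²R⁻²∬_{P(σ₁R)}Λ²`" of (2.8)
before the choice of cut-offs. [cite: LeiRenZhang2019, §2 (2.8) (proof of Lemma 2.1, energy inequality on P_R), arXiv p. 6] -/
theorem energy_inequality_periodic {F N : ℝ → EuclideanSpace ℝ (Fin 3) → ℝ}
    {b : ℝ → EuclideanSpace ℝ (Fin 3) → EuclideanSpace ℝ (Fin 3)}
    {Φ : ℝ → EuclideanSpace ℝ (Fin 3) → ℝ} {t₁ t₂ : ℝ} (ht : t₁ ≤ t₂) (hP : 0 < P)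
    (hF2 : ∀ s, ContDiff ℝ 2 (F s)) (hFa : ∀ s, IsAxisymmetricScalar (F s))
    (hF0 : ∀ s x, cylRadius x = 0 → F s x = 0) (hFp : ∀ s, IsAxiallyPeriodic P (F s))
    (hb1 : ∀ s, ContDiff ℝ 1 (b s)) (hbdiv : ∀ s x, VectorCalculus.divergence (b s) x = 0)
    (hbp : ∀ s, IsAxiallyPeriodic P (b s))
    (hΦ1 : ∀ s, ContDiff ℝ 1 (Φ s)) (hΦp : ∀ s, IsAxiallyPeriodic P (Φ s))
    (hΦz : ∀ s x, fderiv ℝ (Φ s) x eZ = ⟪b s x, horizPart x⟫)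
    (hCΦ : 0 ≤ CΦ) (hΦb : ∀ s x, |Φ s x| ≤ CΦ * cylRadius x)
    (hN : ∀ s x, N s x =
      (Δ (F s)) x - fderiv ℝ (F s) x (b s x) - 2 / cylRadius x * fderiv ℝ (F s) x (eR x))
    (heq : ∀ᵐ x ∂(volume : Measure (EuclideanSpace ℝ (Fin 3))),
      IntervalIntegrable (fun s => N s x) volume t₁ t₂ ∧
        ∀ s ∈ Icc t₁ t₂, F s x = F t₁ x + ∫ τ in t₁..s, N τ x)
    (hH : ContDiff ℝ 2 H) (hH00 : H 0 = 0) (hH0 : ∀ v, 0 ≤ H v)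
    (hH2 : ∀ v, 0 ≤ deriv (deriv H) v) (hκ0 : 0 ≤ κ)
    (hκ : ∀ v, deriv H v ^ 2 ≤ κ * H v * deriv (deriv H) v)
    (hψ : ContDiff ℝ 2 ψ) (hψa : IsAxisymmetricScalar ψ)
    (hψz : ∀ (x : EuclideanSpace ℝ (Fin 3)) (t : ℝ), ψ (x + t • eZ) = ψ x)
    (hψ0 : ∀ x, ρ ≤ cylRadius x → ψ x = 0) (hψr : ∀ x, ψ x * fderiv ℝ ψ x (eR x) ≤ 0)
    (ha : ContDiff ℝ 1 a) (haz : ∀ (x : EuclideanSpace ℝ (Fin 3)) (t : ℝ), a (x + t • eZ) = a x)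
    (hψg : ∀ x, gradient ψ x = a x • horizPart x)
    {η : ℝ → ℝ} (hη : ContDiff ℝ 1 η) (hη0 : ∀ s ∈ Icc t₁ t₂, 0 ≤ η s) (hη1 : η t₁ = 0)
    (hε : 0 < ε)
    (hint : Integrable (fun p : ℝ × EuclideanSpace ℝ (Fin 3) =>
      (deriv H (F p.1 p.2) * N p.1 p.2 * η p.1 + H (F p.1 p.2) * deriv η p.1) *
        (ψ p.2 * periodicWindow P (p.2 2)) ^ 2)
      ((volume.restrict (Ioc t₁ t₂)).prod volume))
    {G M Pψ : ℝ → ℝ}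
    (hG : ∀ s, G s = ∫ x in zSlab P 0, deriv (deriv H) (F s x) * ‖gradient (F s) x‖ ^ 2 * ψ x ^ 2)
    (hM : ∀ s, M s = ∫ x in zSlab P 0, H (F s x) * ψ x ^ 2)
    (hPψ : ∀ s, Pψ s = ∫ x in zSlab P 0, H (F s x) * ‖gradient ψ x‖ ^ 2)
    (hGi : IntervalIntegrable G volume t₁ t₂) (hMi : IntervalIntegrable M volume t₁ t₂)
    (hPi : IntervalIntegrable Pψ volume t₁ t₂) :
    η t₂ * M t₂ + (1 - 2 * ε) * ∫ s in t₁..t₂, η s * G s ≤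
      ∫ s in t₁..t₂, (η s * (κ / ε * (1 + CΦ ^ 2)) * Pψ s + |deriv η s| * M s) := by
  have hηc : Continuous η := hη.continuous
  have hη'c : Continuous (deriv η) := hη.continuous_deriv le_rfl
  -- Step 1: the integrated chain rule under `∫ … φ̃² dx`
  have h1 := integral_comp_mul_sub_eq_integral_integral_ae (μ := volume) ht heq
    (hH.of_le one_le_two) hη (fun x => (ψ x * periodicWindow P (x 2)) ^ 2) hint
  -- the left-hand side is `η(t₂) M(t₂)`
  have hMω : ∀ s, ∫ x, H (F s x) * (ψ x * periodicWindow P (x 2)) ^ 2 = M s := fun s => by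
    rw [hM s]
    exact integral_comp_mul_windowSq_eq hP (hF2 s).continuous (hFp s) hH.continuous hψ.continuous hψz hψ0
  have hLHS : ∫ x, (H (F t₂ x) * η t₂ - H (F t₁ x) * η t₁) * (ψ x * periodicWindow P (x 2)) ^ 2 =
      η t₂ * M t₂ := by
    rw [← hMω t₂, ← MeasureTheory.integral_const_mul]
    refine integral_congr_ae (Eventually.of_forall fun x => ?_)
    simp only [hη1]
    ring
  rw [hLHS] at h1
  -- Step 2: the slice bound, for every `s ∈ [t₁, t₂]`
  have hMnn : ∀ s, 0 ≤ M s := fun s => by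
    rw [hM s]
    exact setIntegral_nonneg (measurableSet_zSlab P 0) fun x _ => mul_nonneg (hH0 _) (sq_nonneg _)
  have hbound : ∀ s ∈ Icc t₁ t₂,
      ∫ x, (deriv H (F s x) * N s x * η s + H (F s x) * deriv η s) * (ψ x * periodicWindow P (x 2)) ^ 2 ≤
        -((1 - 2 * ε) * (η s * G s)) + (η s * (κ / ε * (1 + CΦ ^ 2)) * Pψ s + |deriv η s| * M s) := by
    intro s hs
    have hηs : 0 ≤ η s := hη0 s hs
    -- the two x-integrands are integrable
    have hW : ∀ z, periodicWindow P z ≠ 0 → |z| ≤ 2 * P := fun z hz =>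
      abs_le_of_periodicWindow_ne_zero_pse hP z hz
    have hφt2 : ContDiff ℝ 2 fun y => ψ y * periodicWindow P (y 2) :=
      contDiff_mul_comp_apply_two hψ (contDiff_periodicWindow P)
    have hφtc : HasCompactSupport fun y => ψ y * periodicWindow P (y 2) :=
      hasCompactSupport_mul_comp_apply_two hψ0 hW
    have hφta : IsAxisymmetricScalar fun y => ψ y * periodicWindow P (y 2) :=
      isAxisymmetricScalar_mul_comp_apply_two hψa _
    obtain ⟨hiS, -⟩ := integral_deriv_comp_mul_rhs_mul_sq_eq (hF2 s) (hFa s) (hF0 s) (hb1 s) (hbdiv s)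
      hH hH00 hφt2 hφtc hφta
    have hφt2c : HasCompactSupport fun y => (ψ y * periodicWindow P (y 2)) ^ 2 :=
      hφtc.comp_left (g := fun t : ℝ => t ^ 2) (by simp)
    have hiM : Integrable (fun x => H (F s x) * (ψ x * periodicWindow P (x 2)) ^ 2)
        (volume : Measure (EuclideanSpace ℝ (Fin 3))) :=
      ((hH.continuous.comp (hF2 s).continuous).mul (hφt2.continuous.pow 2)).integrable_of_hasCompactSupport
        hφt2c.mul_left
    have hS := integral_deriv_comp_mul_rhs_mul_windowSq_le hP (hF2 s) (hFa s) (hF0 s) (hFp s) (hb1 s)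
      (hbdiv s) (hbp s) (hΦ1 s) (hΦp s) (hΦz s) hCΦ (hΦb s) hH hH00 hH0 hH2 hκ0 hκ hψ hψa hψz hψ0
      hψr ha haz hψg hε
    rw [← hG s, ← hPψ s] at hS
    -- rewrite the integrand as `η S + η' M`
    have hpt : ∀ x, (deriv H (F s x) * N s x * η s + H (F s x) * deriv η s) *
        (ψ x * periodicWindow P (x 2)) ^ 2 =
        η s * (deriv H (F s x) * ((Δ (F s)) x - fderiv ℝ (F s) x (b s x) -
          2 / cylRadius x * fderiv ℝ (F s) x (eR x)) * (ψ x * periodicWindow P (x 2)) ^ 2) +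
        deriv η s * (H (F s x) * (ψ x * periodicWindow P (x 2)) ^ 2) := by
      intro x
      rw [hN s x]
      ring
    simp_rw [hpt]
    rw [integral_add (hiS.const_mul (η s)) (hiM.const_mul (deriv η s)),
      MeasureTheory.integral_const_mul, MeasureTheory.integral_const_mul, hMω s]
    have h4 : deriv η s * M s ≤ |deriv η s| * M s :=
      mul_le_mul_of_nonneg_right (le_abs_self _) (hMnn s)
    have h5 := mul_le_mul_of_nonneg_left hS hηs
    nlinarith
  -- Step 3: integrate the bound over `[t₁, t₂]`
  have hLi : IntervalIntegrable (fun s => ∫ x, (deriv H (F s x) * N s x * η s + H (F s x) * deriv η s) *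
      (ψ x * periodicWindow P (x 2)) ^ 2) volume t₁ t₂ := by
    rw [intervalIntegrable_iff_integrableOn_Ioc_of_le ht]
    exact hint.integral_prod_left
  have hηi : ∀ {f : ℝ → ℝ}, IntervalIntegrable f volume t₁ t₂ →
      IntervalIntegrable (fun s => η s * f s) volume t₁ t₂ := fun hf =>
    hf.continuousOn_mul hηc.continuousOn
  have hη'i : ∀ {f : ℝ → ℝ}, IntervalIntegrable f volume t₁ t₂ →
      IntervalIntegrable (fun s => |deriv η s| * f s) volume t₁ t₂ := fun hf =>
    hf.continuousOn_mul hη'c.abs.continuousOn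
  have hg₁ : IntervalIntegrable (fun s => η s * (κ / ε * (1 + CΦ ^ 2)) * Pψ s) volume t₁ t₂ :=
    ((hηi hPi).const_mul (κ / ε * (1 + CΦ ^ 2))).congr_ae (Eventually.of_forall fun s => by ring)
  have hg' : IntervalIntegrable (fun s => η s * (κ / ε * (1 + CΦ ^ 2)) * Pψ s + |deriv η s| * M s)
      volume t₁ t₂ := hg₁.add (hη'i hMi)
  have hf' : IntervalIntegrable (fun s => -((1 - 2 * ε) * (η s * G s))) volume t₁ t₂ :=
    ((hηi hGi).const_mul (1 - 2 * ε)).neg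
  have hRi : IntervalIntegrable (fun s => -((1 - 2 * ε) * (η s * G s)) +
      (η s * (κ / ε * (1 + CΦ ^ 2)) * Pψ s + |deriv η s| * M s)) volume t₁ t₂ := hf'.add hg'
  have hmono : ∫ s in t₁..t₂, ∫ x, (deriv H (F s x) * N s x * η s + H (F s x) * deriv η s) *
      (ψ x * periodicWindow P (x 2)) ^ 2 ≤
      ∫ s in t₁..t₂, (-((1 - 2 * ε) * (η s * G s)) +
        (η s * (κ / ε * (1 + CΦ ^ 2)) * Pψ s + |deriv η s| * M s)) := by
    refine intervalIntegral.integral_mono_ae_restrict ht hLi hRi ?_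
    refine (ae_restrict_iff' measurableSet_Icc).2 (Eventually.of_forall fun s hs => hbound s hs)
  have hsplit : ∫ s in t₁..t₂, (-((1 - 2 * ε) * (η s * G s)) +
      (η s * (κ / ε * (1 + CΦ ^ 2)) * Pψ s + |deriv η s| * M s)) =
      -((1 - 2 * ε) * ∫ s in t₁..t₂, η s * G s) +
        ∫ s in t₁..t₂, (η s * (κ / ε * (1 + CΦ ^ 2)) * Pψ s + |deriv η s| * M s) := by
    rw [intervalIntegral.integral_add hf' hg', intervalIntegral.integral_neg,
      intervalIntegral.integral_const_mul]
  rw [hsplit] at hmono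
  linarith [h1.symm.le, h1.le]

end Energy

end LeiRenZhang2019

end Literature.Analysis.FluidPDE

end
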